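import Summits.Ventures.Crystal3D.Theorems.StickyWulffConstantTextureLiminfTexShadowRowStripDefs
import HarnessLib

/-!
# Lane T's `OffR` parameter, two instances from lane G: the reach-based `BarlowPairOffReach` (by cases on `ZigGood`) and the
# TRANSLATION-FREE `FramesApart` (cf-p1 DECISION (xxxvii⁵), §86(127) DR)
# (crux `TextureLiminf`, stmt-Ventures-19483, line `TexShadow` v6.12; supplied by lane G, crux `GenericWallFloor`, stmt-Ventures-19480)

HONEST FRAMING. Venture `Summits/Ventures/Crystal3D` (cell `crystal3d-full`).  DEFINITIONS ONLY (plus unfolding lemmas); nothing is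
claimed about the stubs; rung credit only; F-C1 not moved.  Written by the G-side seat (19480-p2 g8) so that `…TexShadowRowStripDefs`'
`OffR : (E3 ≃ₗᵢ[ℝ] E3) → E3 → (ℤ → ℤ) → (E3 ≃ₗᵢ[ℝ] E3) → E3 → (ℤ → ℤ) → Prop` can be PINNED.

THE FAMILY A PLATE RUNS (lane T's deterministic corner, `ZigGood`): toward its inward vertical `z` the plate `(L, σ)` runs the
ZIGZAG family (up-presentation `upFrame L z`, slot `famSlot L z`, forced chain frames `chainFrames z (upFrame L z) (famSlot L z)` —
`…CoverableDefs`) if `ZigGood L σ z`, else the ROW family on its `++` c-layers (frame `L`, slot `bestLayerDir L z`, frames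
`chainFrames z L (bestLayerDir L z)` with the basal mirror `twinFrame L (L e₃)` adjoined — `…GenericWallFloorBarlowRowBottomFamily`):
`cornerFrame`, `cornerSlot`, `cornerFrames`, `cornerBase` (base point of the reach set), `cornerReach`.

* **`BarlowPairOffReach L₁ s₁ σ₁ L₂ s₂ σ₂`** — the three POSITIONAL clauses of `BarlowOffReach` for the chosen pair of families
  (each reach set misses the other stacking; the two reach sets are disjoint).  This is the `OffR` under which the LANDED row F4
  (`barlowRowRow_/RowZig_/ZigRow_card_le_payers`, `barlow_rowRowLines_le_payers`) and the zig F4 (`barlow_hlines_coverable`) pay.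
* **`CoAxFrames F₁ F₂`** — the two frames' lattices lie in Barlow stackings with ONE common frame (verbatim the co-axiality excluded
  by `card_contacts_add_endStates_le_twelve_sep`'s `hsep`).
* **`FramesApart L₁ s₁ σ₁ L₂ s₂ σ₂`** (OPTION (C) of record): (i) no frame of plate 1's family has plate 2's bilayer lattice
  `L₂·Λ₀` or its basal twin's, (ii) symmetrically, (iii) no frame of family 1 is `CoAxFrames` with a frame of family 2.  It does NOT
  mention `s₁, s₂` (`framesApart_iff_zero`): a property of the LINEAR relation of the two plates and the forced rays only — false
  exactly on the chain-coaxial (registered) classes.  The walker-level consequences (ends off the other plate's core by a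
  frame-avoid lemma; two-family count by `hsep`) are lane G's next files.
WHAT THIS IS NOT: definitions; no wall statement; F-C1 not moved.
-/

noncomputable section

open scoped InnerProductSpace

namespace Summit.Ventures.Crystal3D.Cruxes.TextureLiminf.TexShadow

open Summit.Ventures.Crystal3D Summit.Ventures.Crystal3D.Theorems
open Literature.MathematicalPhysics.StatisticalMechanics (IsHaggSeq barlowStacking fccStacking barlowOffset haggLabel)

/-! ## The family a plate runs toward `z` -/

open scoped Classical in
/-- **The base frame of the corner family**: the up-presentation for zigzags, the presented frame for rows. -/
def cornerFrame (L : E3 ≃ₗᵢ[ℝ] E3) (σ : ℤ → ℤ) (z : E3) : E3 ≃ₗᵢ[ℝ] E3 :=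
  if ZigGood L σ z then upFrame L z else L

open scoped Classical in
/-- **The launch slot of the corner family**: `famSlot` for zigzags, `bestLayerDir` for rows. -/
def cornerSlot (L : E3 ≃ₗᵢ[ℝ] E3) (σ : ℤ → ℤ) (z : E3) : E3 :=
  if ZigGood L σ z then famSlot L z else bestLayerDir L z

open scoped Classical in
/-- **The frame set of the corner family**: the forced chain frames of the zigzag family, or those of the row family with the basal
mirror frame adjoined. -/
def cornerFrames (L : E3 ≃ₗᵢ[ℝ] E3) (σ : ℤ → ℤ) (z : E3) : Set (E3 ≃ₗᵢ[ℝ] E3) :=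
  if ZigGood L σ z then chainFrames z (upFrame L z) (famSlot L z)
  else insert (twinFrame L (L e₃)) (chainFrames z L (bestLayerDir L z))

open scoped Classical in
/-- **The base point of the corner family's reach set** (layer `0` of the presentation the family is launched from). -/
def cornerBase (L : E3 ≃ₗᵢ[ℝ] E3) (s : E3) (σ : ℤ → ℤ) (z : E3) : E3 :=
  if ZigGood L σ z then upFrame L z ((haggLabel (upWord L σ z) 0 : ℝ) • barlowOffset 1) + s
  else L ((haggLabel σ 0 : ℝ) • barlowOffset 1) + s

/-- **The reach set of the corner family.** -/
def cornerReach (L : E3 ≃ₗᵢ[ℝ] E3) (s : E3) (σ : ℤ → ℤ) (z : E3) : Set E3 :=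
  reachSet (cornerFrame L σ z) (cornerBase L s σ z) (cornerFrames L σ z)

/-! ## The reach-based instance -/

/-- **`BarlowPairOffReach`** — the three positional off-reach clauses for the chosen pair of families (zig or row per plate):
each family's reach set misses the other plate's stacking, and the two reach sets are disjoint. -/
def BarlowPairOffReach (L₁ : E3 ≃ₗᵢ[ℝ] E3) (s₁ : E3) (σ₁ : ℤ → ℤ) (L₂ : E3 ≃ₗᵢ[ℝ] E3) (s₂ : E3) (σ₂ : ℤ → ℤ) : Prop :=
  (∀ y ∈ cornerReach L₁ s₁ σ₁ e₃, y ∉ stacking L₂ s₂ σ₂) ∧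
  (∀ y ∈ cornerReach L₂ s₂ σ₂ (-e₃), y ∉ stacking L₁ s₁ σ₁) ∧
  (∀ y ∈ cornerReach L₁ s₁ σ₁ e₃, y ∉ cornerReach L₂ s₂ σ₂ (-e₃))

/-! ## The translation-free instance -/

/-- **Barlow-coaxial frames**: both lattices `Fᵢ·Λ₀` lie in Barlow stackings presented with ONE common frame `L` (verbatim the
relation excluded by `card_contacts_add_endStates_le_twelve_sep`'s separation hypothesis). -/
def CoAxFrames (F₁ F₂ : E3 ≃ₗᵢ[ℝ] E3) : Prop :=
  ∃ (L : E3 ≃ₗᵢ[ℝ] E3) (s₁ s₂ : E3) (σ σ' : ℤ → ℤ), IsHaggSeq σ ∧ IsHaggSeq σ' ∧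
    F₁ '' fccStacking 1 (Real.sqrt (2 / 3)) ⊆ (fun p => L p + s₁) '' barlowStacking 1 (Real.sqrt (2 / 3)) σ ∧
    F₂ '' fccStacking 1 (Real.sqrt (2 / 3)) ⊆ (fun p => L p + s₂) '' barlowStacking 1 (Real.sqrt (2 / 3)) σ'

/-- **`FramesApart`** (OPTION (C), cf-p1 DECISION (xxxvii⁵)): (i) no frame of plate 1's family carries plate 2's bilayer lattice or its
basal twin's, (ii) symmetrically, (iii) no frame of family 1 is Barlow-coaxial with a frame of family 2.  Translation-free. -/
def FramesApart (L₁ : E3 ≃ₗᵢ[ℝ] E3) (_s₁ : E3) (σ₁ : ℤ → ℤ) (L₂ : E3 ≃ₗᵢ[ℝ] E3) (_s₂ : E3) (σ₂ : ℤ → ℤ) : Prop :=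
  (∀ F ∈ cornerFrames L₁ σ₁ e₃,
    F '' fccStacking 1 (Real.sqrt (2 / 3)) ≠ L₂ '' fccStacking 1 (Real.sqrt (2 / 3)) ∧
    F '' fccStacking 1 (Real.sqrt (2 / 3)) ≠ (twinFrame L₂ (L₂ e₃)) '' fccStacking 1 (Real.sqrt (2 / 3))) ∧
  (∀ F ∈ cornerFrames L₂ σ₂ (-e₃),
    F '' fccStacking 1 (Real.sqrt (2 / 3)) ≠ L₁ '' fccStacking 1 (Real.sqrt (2 / 3)) ∧
    F '' fccStacking 1 (Real.sqrt (2 / 3)) ≠ (twinFrame L₁ (L₁ e₃)) '' fccStacking 1 (Real.sqrt (2 / 3))) ∧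
  (∀ F₁ ∈ cornerFrames L₁ σ₁ e₃, ∀ F₂ ∈ cornerFrames L₂ σ₂ (-e₃), ¬ CoAxFrames F₁ F₂)

/-! ## Unfolding -/

/-- The corner data of a `ZigGood` plate. -/
theorem corner_of_zigGood {L : E3 ≃ₗᵢ[ℝ] E3} {σ : ℤ → ℤ} {z : E3} (h : ZigGood L σ z) (s : E3) :
    cornerFrame L σ z = upFrame L z ∧ cornerSlot L σ z = famSlot L z ∧
      cornerFrames L σ z = chainFrames z (upFrame L z) (famSlot L z) ∧
      cornerBase L s σ z = upFrame L z ((haggLabel (upWord L σ z) 0 : ℝ) • barlowOffset 1) + s := by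
  classical
  exact ⟨if_pos h, if_pos h, if_pos h, if_pos h⟩

/-- The corner data of a plate that is not `ZigGood` (it runs rows). -/
theorem corner_of_not_zigGood {L : E3 ≃ₗᵢ[ℝ] E3} {σ : ℤ → ℤ} {z : E3} (h : ¬ ZigGood L σ z) (s : E3) :
    cornerFrame L σ z = L ∧ cornerSlot L σ z = bestLayerDir L z ∧
      cornerFrames L σ z = insert (twinFrame L (L e₃)) (chainFrames z L (bestLayerDir L z)) ∧
      cornerBase L s σ z = L ((haggLabel σ 0 : ℝ) • barlowOffset 1) + s := by
  classical
  exact ⟨if_neg h, if_neg h, if_neg h, if_neg h⟩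

/-- The reach set of a `ZigGood` plate's family is `BarlowOffReach`'s. -/
theorem cornerReach_of_zigGood {L : E3 ≃ₗᵢ[ℝ] E3} {σ : ℤ → ℤ} {z : E3} (h : ZigGood L σ z) (s : E3) :
    cornerReach L s σ z = reachSet (upFrame L z) (upFrame L z ((haggLabel (upWord L σ z) 0 : ℝ) • barlowOffset 1) + s)
      (chainFrames z (upFrame L z) (famSlot L z)) := by
  obtain ⟨h1, -, h3, h4⟩ := corner_of_zigGood h s
  rw [cornerReach, h1, h3, h4]

/-- The reach set of a row plate's family. -/
theorem cornerReach_of_not_zigGood {L : E3 ≃ₗᵢ[ℝ] E3} {σ : ℤ → ℤ} {z : E3} (h : ¬ ZigGood L σ z) (s : E3) :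
    cornerReach L s σ z = reachSet L (L ((haggLabel σ 0 : ℝ) • barlowOffset 1) + s)
      (insert (twinFrame L (L e₃)) (chainFrames z L (bestLayerDir L z))) := by
  obtain ⟨h1, -, h3, h4⟩ := corner_of_not_zigGood h s
  rw [cornerReach, h1, h3, h4]

/-- When both plates are `ZigGood`, `BarlowPairOffReach` is `BarlowOffReach`. -/
theorem barlowPairOffReach_iff_of_zigGood {L₁ L₂ : E3 ≃ₗᵢ[ℝ] E3} {s₁ s₂ : E3} {σ₁ σ₂ : ℤ → ℤ}
    (h₁ : ZigGood L₁ σ₁ e₃) (h₂ : ZigGood L₂ σ₂ (-e₃)) :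
    BarlowPairOffReach L₁ s₁ σ₁ L₂ s₂ σ₂ ↔ BarlowOffReach L₁ s₁ σ₁ L₂ s₂ σ₂ := by
  rw [BarlowPairOffReach, BarlowOffReach, cornerReach_of_zigGood h₁, cornerReach_of_zigGood h₂]

/-- **`FramesApart` is translation-free.** -/
theorem framesApart_iff_zero (L₁ L₂ : E3 ≃ₗᵢ[ℝ] E3) (s₁ s₂ : E3) (σ₁ σ₂ : ℤ → ℤ) :
    FramesApart L₁ s₁ σ₁ L₂ s₂ σ₂ ↔ FramesApart L₁ 0 σ₁ L₂ 0 σ₂ := Iff.rfl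

/-- The separation clause of `FramesApart` in the form `card_contacts_add_endStates_le_twelve_sep` consumes. -/
theorem framesApart_sep {L₁ L₂ : E3 ≃ₗᵢ[ℝ] E3} {s₁ s₂ : E3} {σ₁ σ₂ : ℤ → ℤ} (h : FramesApart L₁ s₁ σ₁ L₂ s₂ σ₂) :
    ∀ F₁ ∈ cornerFrames L₁ σ₁ e₃, ∀ F₂ ∈ cornerFrames L₂ σ₂ (-e₃),
      ¬ ∃ (L : E3 ≃ₗᵢ[ℝ] E3) (t₁ t₂ : E3) (σ σ' : ℤ → ℤ), IsHaggSeq σ ∧ IsHaggSeq σ' ∧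
        F₁ '' fccStacking 1 (Real.sqrt (2 / 3)) ⊆ (fun p => L p + t₁) '' barlowStacking 1 (Real.sqrt (2 / 3)) σ ∧
        F₂ '' fccStacking 1 (Real.sqrt (2 / 3)) ⊆ (fun p => L p + t₂) '' barlowStacking 1 (Real.sqrt (2 / 3)) σ' :=
  h.2.2

end Summit.Ventures.Crystal3D.Cruxes.TextureLiminf.TexShadow

end
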